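import Literature.NumberTheory.EllipticCurves.YanZhu2026.BDPMainConjectureAtTrivialCharacter
import HarnessLib

/-!
# Yan–Zhu 2026 (J. Algebra 693 = arXiv:2412.20078v4), Cor. 5.4 (the CYCLOTOMIC analogue of the BDP
# main conjecture over `K_∞⁺`, integral under (Im)) AT THE TRIVIAL CHARACTER, transported to the
# anticyclotomic module `𝒳_{𝓕_Gr}(E/K_∞⁻)` by Castella–Grossi–Skinner 2025 Prop. 3.4.2
# (`𝓕_Gr(E/K_∞⁺)(0) ∼_p 𝓕_Gr(E/K_∞⁻)(0)`) and evaluated by Castella–Grossi–Lee–Skinner 2022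
# Thm. 5.1.3 — EXACTLY the main-conjecture input of Yan–Zhu's own (v4) proof of the rank-one
# `p`-part of BSD (Thm. 5.11): the RE-SOURCED, PUBLISHED form of the (Im)-integral input that
# `YanZhu2026.thm412_thm513_generator_constantCoeff` (A198) transcribed from arXiv v2

HONEST FRAMING (cell `b2b-bsdres`, run/shared/lean/b2b/bsd-rank1-residual/; page 1 everywhere):
the goal of the cell is to DELETE the COMBINATION-SHAPED residual classes of the BSD formula for ALL
analytic-rank `≤ 1` curves over `ℚ` from PUBLISHED theorems only, so that the remainder becomes
exactly the CONSTRUCTION-SHAPED classes, which are TYPED, not attempted; this is not "finishing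
BSD". This file vendors ONE published (refereed) statement as a named fact (`def … : Prop`, nothing
asserted; D-0014/D-0026) and PROVES its bookkeeping consumers. Unit `b2b-bsdres-lit-glue` (GLUE seat,
gen 12), answering `HOME/b2b-bsdres-lit-glue/WAKE-T2-A198.md` (lit GEN 98 finding
`HOME/b2b-bsdres-lit/g98/DRIFT-READS.md` §F1; referee 2 ruling R2-131.8, which recommends this way (ii)).

## Why this file exists (arXiv-version drift of A198, ruled 2026-08-23)

`YanZhu2026/BDPMainConjectureAtTrivialCharacter.lean` vendors, as
`thm412_thm513_generator_constantCoeff` (registry row A198), "Yan–Zhu Thm. 4.12 (first part) with its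
integral clause under (Im)" ∘ CGLS Thm. 5.1.3. That wording is arXiv **v2** (2025-01-03) §4.5
Thm. 4.12: "Moreover, if (Im) holds, then `Char_{Λ_K}(𝒳(E/K_∞))Λ_K^ur = (𝓛_p^BDP(E/K))`". The CURRENT
text — arXiv v3 ≡ **v4** (2026-01-23), the revision carrying the journal DOI
10.1016/j.jalgebra.2026.01.016 (J. Algebra **693** (2026) 372–402) — renumbers the theorem **Thm. 5.7**
(§5.2) and prints its integral clause under a DIFFERENT hypothesis (TeX `main.tex` l.1224, verbatim):
"Moreover, if the representation `ρ_E|_{G_K} : G_K → Aut_{ℤ_p}(T_pE)` is surjective, then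
`Char_{Λ_K⁻}(𝒳_{𝓕_Gr}(E/K_∞⁻))Λ_K^{ur,−} = (𝓛_p^BDP(E/K))`" (proved via Thm. 5.8 and B. Howard, Compos.
Math. 140 (2004) Thm. B), relegating (Im) to **Remark 5.10** (l.1310–1312, verbatim): "Via [BSTW,
Proposition 12.7], the condition in Theorem 5.7 that `ρ_E|_{G_K}` has full image can be weakened to
condition (Im)." — [BSTW] = Burungale–Skinner–Tian–Wan, arXiv:2409.01350, a PREPRINT. So the
(Im)-integral ANTICYCLOTOMIC clause A198 asserts is, in the refereed text, a remark resting on a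
preprint (cell tier ruling R2-131.8: "PRE-dependent"; the old `def` is left untouched, MIS-STATED
protocol). But v4 ALSO re-routes its own proof of the rank-one `p`-part of BSD (Thm. 5.11 = v2 Thm.
4.15 = Cor. 1.4, content unchanged) AWAY from Thm. 5.7 (proof of Thm. 5.11, l.1347, verbatim):
"the `p`-part of the BSD formula in the rank one case follows from the integral part of **Corollary
5.4**, [CGS, Proposition 3.4.2], the fact that `𝓛_p^Gr(E/K)⁺(1) = 𝓛_p^Gr(E/K)⁻(1) ≠ 0`, and the
descent arguments in [JSW]." This file vendors exactly that sentence MINUS the [JSW] descent — i.e.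
the main-conjecture-level input of the published proof — landing, as A198 does, on a generator of
`ch_Λ(𝒳_{𝓕_Gr}(E/K_∞⁻))` and its constant term, so that every consumer of `h412` re-keys by name.

## The printed chain (all PUBLISHED; locators = arXiv v4 TeX `main.tex`, e-print SHA-256
## `2ebe33f2…fb40`, HOME/b2b-bsdres-lit/g98/eprints/yz_v4.bin; CGS = arXiv:2303.04373v2 TeX
## `Mazur-paper_revised.tex`, SHA-256 `1f0183fb…8b78`, = the Math. Ann. 393 (2025) numbering that
## Yan–Zhu v4 itself cites as "[CGS, Proposition 3.4.2]")

1. **Yan–Zhu Cor. 5.4** (`\label{cyc-BDP}`, l.1166–1180; setting of §5.1, l.1061–1062: "Let `E/ℚ` be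
   an elliptic curve of conductor `N`, and let `p > 2` be a prime at which `E` has good ordinary
   reduction. Assume that the residual representation `ρ̄_E : G_ℚ → Aut(E[p])` is irreducible."; `K`
   an imaginary quadratic field with `p = 𝔭𝔭̄` split, `𝔭` induced by `ι_p`, §1 l.291–292), verbatim:
   "If `𝓛_p^Gr(E/K)⁺` is nontrivial, then `𝒳_{𝓕_Gr}(E/K_∞⁺)` is `Λ_K⁺`-torsion and
   `Char_{Λ_K⁺}(𝒳_{𝓕_Gr}(E/K_∞⁺))Λ_K^{ur,+} ⊗ ℚ_p = (𝓛_p^Gr(E/K)⁺)` in `Λ_K^{ur,+} ⊗ ℚ_p`. Moreover, if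
   condition (Im) holds, we have `Char_{Λ_K⁺}(𝒳_{𝓕_Gr}(E/K_∞⁺))Λ_K^{ur,+} = (𝓛_p^Gr(E/K)⁺)` in
   `Λ_K^{ur,+}`." (proof l.1182–1184: Thm. 5.2 for `E` and `E^K`, Lemma 2.4, Prop. 3.7, [CGS, Prop.
   4.2.1], Prop. 3.8). Here `𝓛_p^Gr(f/K)^±` is "the image of `𝓛_p^Gr(f/K)` under the natural projection
   `Λ_K^ur → Λ_K^{ur,±}`" (§3.5, l.894) and (Im) is display (Im) of Thm. 1.2 (l.349–351): "there exists
   `τ ∈ Gal(ℚ̄/ℚ(μ_{p^∞}))` such that `T_pE/(ρ_E(τ) − 1)T_pE` is free of rank one over `ℤ_p`".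
   HENCE, for a generator `F⁺ ∈ Λ_K⁺ ≅ ℤ_p⟦T⟧` of `Char_{Λ_K⁺}(𝒳_{𝓕_Gr}(E/K_∞⁺))`: `F⁺ = w · 𝓛_p^Gr(E/K)⁺`
   with `w ∈ (Λ_K^{ur,+})^×`, so `F⁺(𝟙) = w(𝟙) · 𝓛_p^Gr(E/K)⁺(𝟙)`, `w(𝟙) ∈ (ℤ_p^ur)^×`.
2. **`𝓛_p^Gr(E/K)⁺(𝟙) = 𝓛_p^Gr(E/K)⁻(𝟙)`** (both are `𝓛_p^Gr(E/K)(𝟙)`; "the trivial character is both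
   cyclotomic and anticyclotomic", CGS l.1504–1510; Yan–Zhu l.1347).
3. **Yan–Zhu Prop. 3.14** (`\label{comp}`, l.896–903, under §3.5's standing "Assume that `D_K` is odd,
   `D_K ≠ −3`, and that the Heegner hypothesis holds", l.882), verbatim: "`𝓛_p^Gr(f/K)⁻ · Λ_K^{ur,−} =
   𝓛_p^BDP(f/K) · Λ_K^{ur,−}`" ("See [CGS, Proposition 2.4.5]"). HENCE `𝓛_p^Gr(E/K)⁻(𝟙) = w'(𝟙) ·
   𝓛_p^BDP(E/K)(𝟙)` with `w'(𝟙) ∈ (ℤ_p^ur)^×`.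
4. **CGLS 2022 Thm. 5.1.3** (Invent. Math. 227; data of §5.1.2), verbatim: "let `p > 2` be a prime of
   good reduction for `E` such that `p = v v̄` splits in `K`. Then `𝓛_E(0) = c_E⁻² · (1 − a_p p⁻¹ +
   p⁻¹)² · log_{ω_E}(P_K)²`" — Yan–Zhu's `𝓛_p^BDP(f/K) ∈ Λ_K^{ur,−}` IS CGLS's `𝓛_E` (Thm. 3.13, l.883–893:
   "See [CGLS, Theorem 2.1.1] for this refined construction"), exactly as in A198 / A173 / File F.
5. **CGS 2025 Prop. 3.4.2** (`\label{prop:euler-char}`, CGS TeX l.1512–1531; §3's standing setting,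
   l.1104: "`E/ℚ` an elliptic curve of conductor `N`, `p` an odd prime of good ordinary reduction for
   `E`, and `K` an imaginary quadratic field satisfying (Heeg) and (spl)", with "all finite primes in
   `Σ` split in `K`", `Σ ⊇ {p, ∞, ℓ ∣ N}`, l.1110–1113), at the trivial twist `α = 1`, `S' = ∅`,
   verbatim: "Suppose `E(K)[p] = 0` and `α : Γ_K⁻ → R^×` is such that the conditions in Lemma 3.4.1
   hold [(a) `corank_R H¹_{𝓕_BK}(K, W_{α⁻¹}) = 1`, (b) the restriction map `H¹_{𝓕_ord}(K, W_{α⁻¹}) →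
   H¹_ord(K_v, W_{α⁻¹})` is nonzero]. Then the Selmer groups `𝔛_Gr^{S'}(E(α)/K_∞⁺)` and
   `𝔛_Gr^{S'}(E(α)/K_∞⁻)` are torsion over `Λ_K⁺` and `Λ_K⁻`, respectively … Furthermore, we have the
   equality up to a `p`-adic unit: `𝓕_Gr^{S'}(E(α)/K_∞⁺)(0) ∼_p 𝓕_Gr^{S'}(E(α)/K_∞⁻)(0)`, where
   `𝓕_Gr^{S'}(E(α)/K_∞^±) ∈ Λ^±_{K,R}` is any characteristic power series for `X_Gr^{S'}(E(α)/K_∞^±)`."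
   (`X_Gr(E/K_∞^±) = H¹_{𝓕_Gr}(K, T_pE ⊗ (Λ_K^±)^∨)^∨`, `𝓕_Gr = 𝓕_{rel,str}`: relaxed at `v`, strict at
   `v̄`, CGS (3.2) l.1146–1155 — the SAME module as Yan–Zhu's `𝒳_{𝓕_Gr}(E/K_∞^±)`, Def. 2.1 l.473–499.)
   HENCE `F⁻(𝟙) = u'' · F⁺(𝟙)` with `u'' ∈ ℤ_p^×` for any generator `F⁻` of `Char_{Λ_K⁻}(𝒳_{𝓕_Gr}(E/K_∞⁻))`.

COMBINED (1–5): `𝒳_{𝓕_Gr}(E/K_∞⁻)` is `Λ_K⁻`-torsion and `F⁻(𝟙) = U · c_E⁻² (1 − a_p p⁻¹ + p⁻¹)²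
log_{ω_E}(P_K)²` with `U = u''·w(𝟙)·w'(𝟙) ∈ (ℤ_p^ur)^×`; the identity lives in `K_v = ℚ_p` (`F⁻(𝟙) ∈
ℤ_p`), and the right-hand value is NON-ZERO under the binders below (`P_K` non-torsion ⇒
`log_{ω_E}(P_K) ≠ 0`; `1 − a_p p⁻¹ + p⁻¹ = #Ẽ(𝔽_p)/p ≠ 0`; `c_E ≠ 0`), so `U ∈ ℚ_p ∩ (ℤ_p^ur)^× =
ℤ_p^×` — the conclusion of A198 VERBATIM, now resting on Cor. 5.4 + Prop. 3.14 + CGS Prop. 3.4.2 +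
CGLS Thm. 5.1.3, all refereed, and on NO anticyclotomic integral main conjecture.

## Transcription (tree vocabulary; binders = A198's plus three, each implying a printed hypothesis)

* A198's binders verbatim (see that file's module docstring for the dictionary): `W` globally
  minimal, `3 ≤ p`, `GoodOrd W p`, `BigIm W p` = (Im); `K` imaginary quadratic,
  `SatisfiesHeegnerHypothesis (W.conductorNorm ℤ) K` (every `ℓ ∣ N` SPLITS in `K` — this is CGS's
  (Heeg) ∧ "all finite primes in `Σ` split in `K`" and Yan–Zhu §2.1's "`(N, D_K) = 1`", §3.5's Heegner
  hypothesis), `SatisfiesHeegnerHypothesis p K` ((spl)), `Odd (discr K)`, `discr K ≠ -3` (§3.5),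
  `(W.baseChange K).HasIrreducibleModPGaloisRep p` = (irr_K) — which implies BOTH printed
  hypotheses of this chain: `ρ̄_E : G_ℚ → Aut(E[p])` irreducible (§5.1; a `G_ℚ`-stable line is
  `G_K`-stable) and CGS's "`E(K)[p] = 0`" (a non-zero `K`-rational `p`-torsion point spans a
  `G_K`-stable line of `E[p]`); `(ι, v, vbar, κ, γ)` with `κ` ANTICYCLOTOMIC, `𝒳_{𝓕_Gr}(E/K_∞⁻) =
  AcSelmer.XAc (W.baseChange K) p κ vbar ∅ γ` (strict at `v̄`, relaxed at `v`; `K_∞`-formulation — the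
  cell flag `JSW-331-Kinf-formulation` travels); `(Dt, H, ιC, P)` the classical Heegner datum with
  `ιC(P) = P_K`, `Dt.c = c_E`; `log_{ω_E}(P_K) = log_W(z(m₀ • P_ι))/m₀`.
* NEW binders (the vocabulary of `JetchevSkinnerWan2017.thm331_anticyclotomicControl`, A174, which
  every consumer of `h412` already carries for its control link): `(W.baseChange K).mordellWeilRank
  = 1` and `Finite (Ш(E/K)[p^∞])` — together they give `corank_{ℤ_p} Sel_{p^∞}(E/K) = 1`, i.e. CGS
  Lemma 3.4.1 (a) at `α = 1` (`H¹_{𝓕_BK} = H¹_{𝓕_ord}` has the corank of `Sel_{p^∞}(E/K)` at a good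
  ordinary `p`); `¬ IsOfFinAddOrder P` (`P_K` non-torsion) — it gives (b) (the Kummer image of `P_K`
  has non-zero restriction to `H¹_ord(K_v, W) ⊇ E(K_v) ⊗ ℚ_p/ℤ_p`, `P_K` being of infinite order in
  `E(K_v) ≅ ℤ_p × finite`) AND Cor. 5.4's "`𝓛_p^Gr(E/K)⁺` is nontrivial" (by 2–4, `𝓛_p^Gr(E/K)⁺(𝟙)` is
  a unit multiple of `c_E⁻²(1 − a_p p⁻¹ + p⁻¹)² log_{ω_E}(P_K)² ≠ 0`). Each new binder only WEAKENS
  the fact relative to the printed statements.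
  `-- TODO(general form): CGS Prop. 3.4.2 for a general anticyclotomic twist α ≡ 1 (mod ϖ^m) and`
  `-- S' ⊂ Σ, with hypotheses (a), (b) of Lemma 3.4.1 as printed; Cor. 5.4 as an identity of ideals`
  `-- of Λ_K^{ur,+} (needs Λ^ur and 𝓛_p^Gr as objects; the cell works at the trivial character only).`
* Conclusion: A198's, symbol for symbol.

## Contents

* `cor54_prop342_thm513_generator_constantCoeff` — the named fact (ONE new `def … : Prop`).
* PROVED: `cor54_prop342_thm513_generator_constantCoeff_of_thm412` (the v2-worded A198 implies it:
  the re-sourced fact asks LESS of the literature), `generator_constantCoeff_eq_of_cor54`,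
  `valuation_generator_constantCoeff_of_cor54`, `hasCharValuationAt_of_cor54` (the packaged currency
  `∃ n, AcSelmer.XAc.HasCharValuationAt … n ∧ n = 2·(ord_p(1 − a_p + p) − 1 + ord_p log_{ω_E} P_K) −
  2·ord_p c_E` consumed by `X11b.imcWaldspurgerOnTreeGoodAt_inducedPlace_of_thm412_of_thm331`, whose
  binder list ALREADY contains `hrk`, `hfinp`, `hPinf`: the Summits re-keying is
  `hasCharValuationAt_of_thm412 h412 … ↦ hasCharValuationAt_of_cor54 h54 … hrk hfinp hPinf`).

CELL FLAGS inherited (documentation; the tier is the referee's): `YZ26@3-BF-ERL-Ohta` (Cor. 5.4 rests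
on Thm. 5.2 = v2 Thm. 4.9, whose two-variable input Thm. 4.2/4.7 uses Beilinson–Flach explicit
reciprocity / `Λ`-adic Eichler–Shimura inputs in print for `p ≥ 5`; the statement vendored is the
refereed statement, valid as printed at every `p > 2`); `CGS25-BST-Thm311` travels with [CGS, Prop.
4.2.1] inside the proof of Cor. 5.4; `JSW-331-Kinf-formulation` (module identification). NOT used by
this chain: Howard 2004 Thm. B, [BSTW] (any proposition), Yan–Zhu Thm. 5.7/5.8/Rem. 5.10.

D-AUDIT OF RECORD at `p = 3` (cell `bsd-litref/yz26`, typer seat `bsd-litref-yz26-ty`, 2026-08-26;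
docstring-only addendum, the statement below is byte-identical to p358701; full text in the sibling
`YanZhu2026/PPartBSD.lean`, section "v4 READING OF RECORD"). Reader sheets (two,
independent, concurring) `run/shared/lean/pub/bsd-litref/yz26/sheets/D-AUDIT-yz26-r1.md` (sha16
`afcaff78c72f86dd`) and `…/D-AUDIT-T2c-yz26-r2.md` (sha16 `156794b7540493ec`), both SEALED, with
post-seal ADDENDA-1 `…/D-AUDIT-yz26-r1-ADDENDUM-1.md` (sha16 `ed8bed88180f8d5e`) and
`…/D-AUDIT-T2c-yz26-r2-ADDENDUM-1.md` (sha16 `2075b9099f88ace7`) (concordance; gap width settled at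
the page: `Λ_D`-projectivity/control is refereed print at every `p` by Hida, *Elementary Modular
Iwasawa Theory* (2022) Thm. 4.2.37 and the `Λ_D`-pairing is formal given it — the residual is exactly
the `Λ`-adic Eichler–Shimura package at `(3, ω⁰)` and `(3, ω⁻¹)`; every D3 class is surj(3)); all
filed to the D-audit desk (referee C2 =
pub-bsdpct-r4, from 2026-08-26T19:22Z referee C = pub-bsdpct-r3); referee C's ruling: R361 (2026-08-26T21:22:43Z, yz26 group ruling, all four wakes): «STATEMENT VERBATIM ×2 CONCUR (desk
PC/NC conforming); HYPOTHESES MET with both addenda sharpenings ADOPTED; PROOF INPUTS AT 3: GAP(BSTW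
p0029:L7) CONFIRMED at ONE node with TWO prongs G♯ ∧ G♭ — both prongs re-found at this desk on its own pages;
flag re-wording GRANTED (two-prong); row D3 stays LITERAL, 0 of 4 814 cells move» (R361.3 (γ): width
resolution ADOPTED — the gap is EXACTLY the ES rows; (δ) T0 BY NAME; (ε) register-wide prong map + strike test
for referee A; two-prong string of record in `YanZhu2026/PPartBSD.lean`, "Cell flag" paragraph);
referee A: not seized of any move — GAP(line) ⇒ 0 move; the record note (re-wording + prong map + acq-11255 correction + p454928) is the lead's PRICING-D3-YZ26-v1 (sha16 8dbaebf5a815cdf8) filed to A 2026-08-26T21:25Z, round pending (cell lead rulings 21:02:36Z / 21:25:52Z). The readers' finding, two independent and concurring, statement VERBATIM: on THIS chain (the `r = 1` leg of v4 Thm. 5.11, l.1347) the Beilinson–Flach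
input enters TWICE and bottoms out in ONE item: Cor. 5.4's proof (l.1182–1184) cites "[CGS,
Proposition 4.2.1] (a cyclotomic analogue of Theorem 4.7, see also [BSTW, Proposition 9.18])" ←
Castella–Grossi–Skinner 2025 Thm. 4.1.1 "proved in [BSTW23, §5]" (flag `CGS25-BST-Thm311` above), and
Thm. 5.2 (used for `E` and `E^K`) ⇐ Thm. 4.7 (v4 l.1022–1034). The equivalence LOGIC (BSTW II Prop.
1.18 / CGS Prop. 4.2.1) PASSES in cell; its explicit reciprocity laws rest at `p = 3` on the Ohta–Hida
`Λ_D`-adic package BSTW Thm. 3.1–3.2 (= KLZ17 Prop. 7.2.1 / Thm. 7.2.3 / Thm. 9.5.1–2 / Prop. 10.1.1),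
printed for `p ≥ 5` only and sourced at `3` by arXiv:2409.01350v2 p. 29 ("likely apply … [Ca] …
some parts … [SV-S-Ohta]") — **GAP(BSTW p0029:L7)**, two prongs: (G1 = r2's G♯) the Hida family through `f_E^α`
sits on the TRIVIAL `μ₂`-component at `p = 3` (excluded by Cais 2018's `e*′` and Ohta 1995/1999; no
printed source); (G2 = r2's G♭) the CM family `𝐡_v` (component `ω^{−1}`) is residually Eisenstein and needs the
open-curve row of BSTW Thm. 3.1 (ii) (Cais: closed-curve `e*′` parts only; rest [SV-S-Ohta],
unpublished/unlocated 2026-08-26). This SHARPENS the first inherited flag above (two prongs instead of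
"inputs in print for `p ≥ 5`"); not DISPUTED; statement-level grade unchanged. Typed target of record
for the gap on row C16, by NAME: the body of THIS fact at `p = 3`, whose consumer
`RowC16.bsdp_of_publishedFacts_of_identityLink_of_cor54` (Summits
`Rank1Residual/Partition/CornersMainConjecturesCor54.lean`) is PROVED — no new declaration (the
`Λ`-adic modular-forms tower is below tree vocabulary).

## References
* [YanZhu2026] = [YanZhu2024MainConjNonCM] v4: §1 (l.282–331: conventions, `𝓛_p^Gr ∈ Λ_K^ur`, Conj.
  1.1), Thm. 1.2 with (Im) (l.336–353), Cor. 1.4 (l.384–391), §2.1 Def. 2.1 (l.467–499), Lemma 2.4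
  (`sum`), Lemma 2.6 (`bdp_des`), §3.3 Prop. 3.7 (`PR-MSD`), Prop. 3.8 (`non1`), §3.4 Def. 3.11
  (`𝓛_p^Gr`), §3.5 (l.880–903: Thm. 3.13 `𝓛_p^BDP`, Prop. 3.14 `comp`), §5.1 (l.1059–1184: setting,
  Thm. 5.2, Lemma 5.3, Cor. 5.4), §5.2 (l.1187–1312: Conj. 5.5, Thm. 5.7, Thm. 5.8, Rem. 5.10),
  §5.3 Thm. 5.11 and its proof (l.1319–1348). Journal pages unread (acq-10397: journal == v4?).
* [CastellaGrossiSkinner2025] Math. Ann. 393 (2025) 2451–2506 = arXiv:2303.04373v2: §3 setting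
  (l.1102–1113), (3.2) (l.1146–1155), Lemma 3.4.1 (`lem:coinv`, l.1469–1486), Prop. 3.4.2
  (`prop:euler-char`, l.1512–1531) and its proof (l.1533–1581); Prop. 2.4.5; Prop. 4.2.1.
  (arXiv v1 numbers: Prop. 2.3.2, Lemma 2.3.1, Prop. 1.4.5, Prop. 3.2.1.)
* [CastellaGrossiLeeSkinner2022] Invent. Math. 227 (2022): Thm. 5.1.3 with §5.1.2; Thm. 2.1.1.
* [JetchevSkinnerWan2017] Thm. 3.3.1 (the descent this input feeds; A174's binder vocabulary).
* Tree: `YanZhu2026/BDPMainConjectureAtTrivialCharacter.lean` (A198, the v2-worded sibling, kept),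
  `BurungaleCastellaSkinner2025/BDPMainConjectureAtTrivialCharacter.lean` (File F, `p > 3`, (sur)),
  `CastellaGrossiLeeSkinner2022/BDPValueAtTrivialCharacter.lean` (A173),
  `JetchevSkinnerWan2017/AnticyclotomicControl.lean` (A174); HOME/b2b-bsdres-lit/g98/DRIFT-READS.md
  §F1; HOME/REFEREE-2.md `## Gen 131` R2-131.8; HOME/b2b-bsdres-lit-glue/GLUE.md GEN 12 ADDENDUM.
-/

set_option autoImplicit false

noncomputable section

open scoped Classical

open WeierstrassCurve NumberField IsDedekindDomain Field Literature.NumberTheory.EllipticCurves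
  Literature.NumberTheory.EllipticCurves.ModularForms Literature.NumberTheory.QuadraticFields
  Literature.NumberTheory.EllipticCurves.Rank1Residual
  Literature.NumberTheory.EllipticCurves.Castella2018

namespace Literature.NumberTheory.EllipticCurves.YanZhu2026

/-- **Yan–Zhu, J. Algebra 693 (2026) = arXiv:2412.20078v4, Corollary 5.4 (integral clause under
(Im)) at the trivial character, transported to `𝒳_{𝓕_Gr}(E/K_∞⁻)` by Castella–Grossi–Skinner, Math.
Ann. 393 (2025), Proposition 3.4.2 and evaluated by Castella–Grossi–Lee–Skinner, Invent. Math. 227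
(2022), Theorem 5.1.3 — assembled exactly as Yan–Zhu's proof of Thm. 5.11 (rank one) assembles them**
("the `p`-part of the BSD formula in the rank one case follows from the integral part of Corollary
5.4, [CGS, Proposition 3.4.2], the fact that `𝓛_p^Gr(E/K)⁺(1) = 𝓛_p^Gr(E/K)⁻(1) ≠ 0`, and the descent
arguments in [JSW]", v4 `main.tex` l.1347). Setting of §5.1 (verbatim): "Let `E/ℚ` be an elliptic
curve of conductor `N`, and let `p > 2` be a prime at which `E` has good ordinary reduction. Assume
that the residual representation `ρ̄_E : G_ℚ → Aut(E[p])` is irreducible."; `K` imaginary quadratic,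
`p = 𝔭𝔭̄` split, `𝔭` induced by `ι_p` (§1); §3.5 (standing, for `𝓛_p^BDP`): "Assume that `D_K` is odd,
`D_K ≠ −3`, and that the Heegner hypothesis holds." **Cor. 5.4** (verbatim): "If `𝓛_p^Gr(E/K)⁺` is
nontrivial, then `𝒳_{𝓕_Gr}(E/K_∞⁺)` is `Λ_K⁺`-torsion and `Char_{Λ_K⁺}(𝒳_{𝓕_Gr}(E/K_∞⁺))Λ_K^{ur,+} ⊗ ℚ_p
= (𝓛_p^Gr(E/K)⁺)` in `Λ_K^{ur,+} ⊗ ℚ_p`. Moreover, if condition (Im) holds, we have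
`Char_{Λ_K⁺}(𝒳_{𝓕_Gr}(E/K_∞⁺))Λ_K^{ur,+} = (𝓛_p^Gr(E/K)⁺)` in `Λ_K^{ur,+}`." — (Im): "there exists `τ ∈
Gal(ℚ̄/ℚ(μ_{p^∞}))` such that `T_pE/(ρ_E(τ) − 1)T_pE` is free of rank one over `ℤ_p`". **Prop. 3.14**
(verbatim): "`𝓛_p^Gr(f/K)⁻ · Λ_K^{ur,−} = 𝓛_p^BDP(f/K) · Λ_K^{ur,−}`" (= [CGS, Prop. 2.4.5]); `𝓛_p^Gr(f/K)^±`
the images of `𝓛_p^Gr(f/K) ∈ Λ_K^ur` in `Λ_K^{ur,±}`, so `𝓛_p^Gr(E/K)⁺(𝟙) = 𝓛_p^Gr(E/K)(𝟙) = 𝓛_p^Gr(E/K)⁻(𝟙)`.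
**CGS Prop. 3.4.2** at `α = 1`, `S' = ∅` (verbatim; §3 setting: `p` odd good ordinary, `K` with
(Heeg), (spl), every finite prime of `Σ ⊇ {p, ∞, ℓ ∣ N}` split in `K`): "Suppose `E(K)[p] = 0` and
`α : Γ_K⁻ → R^×` is such that the conditions in Lemma 3.4.1 hold [(a) `corank_R H¹_{𝓕_BK}(K,
W_{α⁻¹}) = 1`; (b) `H¹_{𝓕_ord}(K, W_{α⁻¹}) → H¹_ord(K_v, W_{α⁻¹})` is nonzero]. Then the Selmer groups
`𝔛_Gr^{S'}(E(α)/K_∞⁺)` and `𝔛_Gr^{S'}(E(α)/K_∞⁻)` are torsion over `Λ_K⁺` and `Λ_K⁻`, respectively …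
Furthermore, we have the equality up to a `p`-adic unit: `𝓕_Gr^{S'}(E(α)/K_∞⁺)(0) ∼_p
𝓕_Gr^{S'}(E(α)/K_∞⁻)(0)`, where `𝓕_Gr^{S'}(E(α)/K_∞^±) ∈ Λ^±_{K,R}` is any characteristic power series
for `X_Gr^{S'}(E(α)/K_∞^±)`." (`X_Gr = H¹_{𝓕_{rel,str}}(K, T_pE ⊗ (Λ_K^±)^∨)^∨`: relaxed at `v`, strict
at `v̄`.) **CGLS Thm. 5.1.3** (verbatim, data of §5.1.2: `π : X₀(N) → E`, `P_K = Σ_σ π(x₁)^σ ∈ E(K)`,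
`c_E` the Manin constant): "let `p > 2` be a prime of good reduction for `E` such that `p = v v̄`
splits in `K`. Then `𝓛_E(0) = c_E⁻² · (1 − a_p p⁻¹ + p⁻¹)² · log_{ω_E}(P_K)²`" (Yan–Zhu's `𝓛_p^BDP(f/K)`
is CGLS's `𝓛_E`, Thm. 3.13). COMBINED: a generator `F⁻` of `Char_{Λ_K⁻}(𝒳_{𝓕_Gr}(E/K_∞⁻))` has `F⁻(𝟙)
∼_p F⁺(𝟙) = w(𝟙) 𝓛_p^Gr(E/K)⁺(𝟙) = w(𝟙) 𝓛_p^Gr(E/K)⁻(𝟙) = w(𝟙) w'(𝟙) 𝓛_p^BDP(E/K)(𝟙)`, `w(𝟙), w'(𝟙) ∈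
(ℤ_p^ur)^×`, i.e. `F⁻(𝟙) = U · c_E⁻² (1 − a_p p⁻¹ + p⁻¹)² log_{ω_E}(P_K)²` with `U ∈ (ℤ_p^ur)^× ∩ ℚ_p =
ℤ_p^×` (the value is non-zero for `P_K` of infinite order). TRANSCRIBED (module docstring for the
dictionary): the binders of `thm412_thm513_generator_constantCoeff` verbatim — `W` globally minimal,
`3 ≤ p`, `GoodOrd W p`, `BigIm W p` (Im), `K` imaginary quadratic with the Heegner hypothesis for
`N_E` (every `ℓ ∣ N` splits: (Heeg), "`Σ`-primes split", "`(N, D_K) = 1`"), `p` split ((spl)),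
`D_K` odd `≠ −3`, `(W.baseChange K).HasIrreducibleModPGaloisRep p` ((irr_K), which implies the
printed "`ρ̄_E` irreducible" of §5.1 and CGS's "`E(K)[p] = 0`"), `(ι, v, vbar, κ, γ)` with `κ`
anticyclotomic and `𝒳_{𝓕_Gr}(E/K_∞⁻) = AcSelmer.XAc (W.baseChange K) p κ vbar ∅ γ`, `(Dt, H, ιC, P)`
with `Dt.c = c_E`, `ιC(P) = P_K`, `log_{ω_E}(P_K) = log_W(z(m₀ • P_ι))/m₀` — PLUS, in the vocabulary of
`JetchevSkinnerWan2017.thm331_anticyclotomicControl`: `rank_ℤ E(K) = 1` and `#Ш(E/K)[p^∞] < ∞`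
(together: CGS Lemma 3.4.1 (a), `corank_{ℤ_p} Sel_{p^∞}(E/K) = 1`) and `P_K` of infinite order
(Lemma 3.4.1 (b), and Cor. 5.4's "`𝓛_p^Gr(E/K)⁺` nontrivial" via Prop. 3.14 + Thm. 5.1.3);
conclusion IDENTICAL to A198's: `𝒳_{𝓕_Gr}(E/K_∞⁻)` is `Λ`-torsion and there is a generator `F` of
`ch_Λ(𝒳_{𝓕_Gr})` and `u ∈ ℤ_p^×` with `F(0) = u · c_E⁻² · (1 − a_p p⁻¹ + p⁻¹)² · log_{ω_E}(P_K)²` in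
`ℚ_p`. COMPOSITE OF PRINTED, PUBLISHED THEOREMS assembled as the authors' own proof of Thm. 5.11
assembles them; nothing asserted; no use of Thm. 5.7 / Rem. 5.10 / [BSTW] / Howard 2004. Cell
documentation flags `YZ26@3-BF-ERL-Ohta`, `CGS25-BST-Thm311`, `JSW-331-Kinf-formulation` (module
docstring).
[cite: YanZhu2026, Cor. 5.4 (§5.1; arXiv:2412.20078v4 TeX l.1166–1184) with the setting of §5.1 (l.1061–1062), display (Im) (l.349–351), Prop. 3.14 (l.896–903), Thm. 3.13 (l.883–893), §3.5 (l.882) and the proof of Thm. 5.11 (l.1347)]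
[cite: CastellaGrossiSkinner2025, Prop. 3.4.2 (arXiv:2303.04373v2 TeX `prop:euler-char`, l.1512–1531) with Lemma 3.4.1 (l.1469–1486) and the setting of §3 (l.1104–1113); Prop. 2.4.5]
[cite: CastellaGrossiLeeSkinner2022, Thm. 5.1.3 (TeX `thmpadicGZ`, L2463–L2471) with §5.1.2 (L2434–L2447)]
[cite: BertoliniDarmonPrasanna2013, Thm. 5.13 (the source of Thm. 5.1.3)] -/
def cor54_prop342_thm513_generator_constantCoeff : Prop :=
  ∀ (W : WeierstrassCurve ℚ) [W.IsElliptic] [W.IsGloballyMinimal] (p : ℕ) [Fact p.Prime],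
    3 ≤ p → GoodOrd W p → BigIm W p →
    ∀ (K : Type) [Field K] [NumberField K], IsImaginaryQuadratic K →
      SatisfiesHeegnerHypothesis (W.conductorNorm ℤ) K → SatisfiesHeegnerHypothesis p K →
      Odd (NumberField.discr K) → NumberField.discr K ≠ -3 →
      (W.baseChange K).HasIrreducibleModPGaloisRep p →
    ∀ (ι : K →+* ℚ_[p]) (v vbar : HeightOneSpectrum (𝓞 K)),
      (∀ x : 𝓞 K, x ∈ v.asIdeal ↔ ‖ι (x : K)‖ < 1) →
      ((p : ℕ) : 𝓞 K) ∈ vbar.asIdeal → vbar ≠ v →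
    ∀ (κ : ZpExtension K p), κ.IsAnticyclotomic →
    ∀ (γ : absoluteGaloisGroup K) [Fact (κ.IsTopGenerator γ)],
    ∀ (N : ℕ) [NeZero N] (Dt : ModularParametrizationData W N)
      (H : HeegnerDatum N (NumberField.discr K)) (ιC : K →+* ℂ) (P : (W.baseChange K).toAffine.Point),
      WeierstrassCurve.Affine.Point.map ιC.toRatAlgHom P = heegnerPointComplex Dt H →
      (W.baseChange K).mordellWeilRank = 1 →
      Finite (AddCommGroup.primaryComponent (W.baseChange K).sha p) →
      ¬ IsOfFinAddOrder P →
      Module.IsTorsion (IwasawaAlgebra p) (AcSelmer.XAc (W.baseChange K) p κ vbar ∅ γ) ∧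
      ∃ F : IwasawaAlgebra p,
        AcSelmer.XAc.charIdeal (W.baseChange K) p κ vbar ∅ γ = Ideal.span {F} ∧
        ∃ u : ℤ_[p]ˣ,
          ((PowerSeries.constantCoeff F : ℤ_[p]) : ℚ_[p]) =
            ((u : ℤ_[p]) : ℚ_[p]) * ((Dt.c : ℚ_[p])⁻¹) ^ 2 *
              (1 - (W.frobeniusTrace p : ℚ_[p]) * (p : ℚ_[p])⁻¹ + (p : ℚ_[p])⁻¹) ^ 2 *
              ((W.baseChange ℚ_[p]).padicLogPoint (formalIndex W p • padicPointOf W p ι P) /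
                (formalIndex W p : ℚ_[p])) ^ 2

/-- **The v2-worded fact implies the re-sourced one** (documentation: the re-sourced statement asks
LESS of the literature — the same conclusion under three more hypotheses). In particular every
consumer of A198 re-keys to this fact by supplying `rank_ℤ E(K) = 1`, `#Ш(E/K)[p^∞] < ∞` and the
non-torsion of `P_K`, which the consumers of the control fact JSW Thm. 3.3.1 already carry.
[cite: YanZhu2026, Cor. 5.4, Thm. 5.7, Rem. 5.10, proof of Thm. 5.11 (arXiv:2412.20078v4 TeX l.1166–1184, l.1217–1242, l.1310–1312, l.1347)] -/
theorem cor54_prop342_thm513_generator_constantCoeff_of_thm412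
    (h : thm412_thm513_generator_constantCoeff) : cor54_prop342_thm513_generator_constantCoeff :=
  fun W _ _ p _ hp hord him K _ _ hK hHN hHp hodd h3 hirr ι v vbar hv hvbar hne κ hκ γ _ N _ Dt H ιC P
    hP _ _ _ ↦
    h W p hp hord him K hK hHN hHp hodd h3 hirr ι v vbar hv hvbar hne κ hκ γ N Dt H ιC P hP

/-! ### A `p`-adic valuation computation (standard API; no mathematical content of its own) -/

section Valuation

variable {p : ℕ} [hp : Fact p.Prime]

/-- `ord_p` of the right-hand side of Cor. 5.4 ∘ Prop. 3.14 ∘ Prop. 3.4.2 ∘ Thm. 5.1.3: for a unit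
`u ∈ ℤ_p^×`, integers `c, a`, `L ∈ ℚ_p` and `m ∈ ℕ`, if `u · c⁻² · (1 − a p⁻¹ + p⁻¹)² · (L/m)² ≠ 0`
then its valuation is `2·(ord_p(1 − a + p) − 1 + (ord_p L − ord_p m)) − 2·ord_p c` (each factor is
non-zero, `ord_p` is additive, `1 − a p⁻¹ + p⁻¹ = (1 − a + p)/p`). Private helper (the same
computation as in A198 / File F / A173, whose copies are private to their modules). [folklore] -/
private theorem valuation_unit_mul_bdpShape_yz54 (u : ℤ_[p]ˣ) (c a : ℤ) (L : ℚ_[p]) (m : ℕ)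
    (h : ((u : ℤ_[p]) : ℚ_[p]) * ((c : ℚ_[p])⁻¹) ^ 2 *
        (1 - (a : ℚ_[p]) * (p : ℚ_[p])⁻¹ + (p : ℚ_[p])⁻¹) ^ 2 * (L / (m : ℚ_[p])) ^ 2 ≠ 0) :
    (((u : ℤ_[p]) : ℚ_[p]) * ((c : ℚ_[p])⁻¹) ^ 2 *
        (1 - (a : ℚ_[p]) * (p : ℚ_[p])⁻¹ + (p : ℚ_[p])⁻¹) ^ 2 * (L / (m : ℚ_[p])) ^ 2).valuation =
      2 * ((padicValInt p (1 - a + p) : ℤ) - 1 + (L.valuation - (padicValNat p m : ℤ))) -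
        2 * (padicValInt p c : ℤ) := by
  have hp0 : (p : ℚ_[p]) ≠ 0 := by exact_mod_cast hp.out.ne_zero
  have hu0 : ((u : ℤ_[p]) : ℚ_[p]) ≠ 0 := PadicInt.coe_ne_zero.2 u.ne_zero
  have hc0 : ((c : ℚ_[p])⁻¹) ≠ 0 := by
    intro h0; apply h; rw [h0]; ring
  have hA0 : (1 - (a : ℚ_[p]) * (p : ℚ_[p])⁻¹ + (p : ℚ_[p])⁻¹) ≠ 0 := by
    intro h0; apply h; rw [h0]; ring
  have hLm0 : L / (m : ℚ_[p]) ≠ 0 := by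
    intro h0; apply h; rw [h0]; ring
  have hL0 : L ≠ 0 := by
    intro h0; apply hLm0; rw [h0, zero_div]
  have hm0 : (m : ℚ_[p]) ≠ 0 := by
    intro h0; apply hLm0; rw [h0, div_zero]
  -- `1 − a p⁻¹ + p⁻¹ = (1 − a + p)/p`
  have hAeq : (1 - (a : ℚ_[p]) * (p : ℚ_[p])⁻¹ + (p : ℚ_[p])⁻¹) =
      ((1 - a + p : ℤ) : ℚ_[p]) * (p : ℚ_[p])⁻¹ := by
    push_cast
    field_simp
    ring
  have hA1 : ((1 - a + p : ℤ) : ℚ_[p]) ≠ 0 := by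
    intro h0; apply hA0; rw [hAeq, h0, zero_mul]
  -- valuations of the four factors
  have hvu : ((u : ℤ_[p]) : ℚ_[p]).valuation = 0 := by
    simp only [PadicInt.valuation_coe, padicInt_valuation_eq_zero_of_isUnit u.isUnit, Nat.cast_zero]
  have hvc : ((c : ℚ_[p])⁻¹).valuation = -(padicValInt p c : ℤ) := by
    rw [Padic.valuation_inv, Padic.valuation_intCast]
  have hvA : (1 - (a : ℚ_[p]) * (p : ℚ_[p])⁻¹ + (p : ℚ_[p])⁻¹).valuation =
      (padicValInt p (1 - a + p) : ℤ) - 1 := by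
    rw [hAeq, Padic.valuation_mul hA1 (inv_ne_zero hp0), Padic.valuation_intCast,
      Padic.valuation_inv, Padic.valuation_p]
    ring
  have hvL : (L / (m : ℚ_[p])).valuation = L.valuation - (padicValNat p m : ℤ) := by
    rw [div_eq_mul_inv, Padic.valuation_mul hL0 (inv_ne_zero hm0), Padic.valuation_inv,
      Padic.valuation_natCast]
    ring
  rw [Padic.valuation_mul (mul_ne_zero (mul_ne_zero hu0 (pow_ne_zero 2 hc0)) (pow_ne_zero 2 hA0))
      (pow_ne_zero 2 hLm0),
    Padic.valuation_mul (mul_ne_zero hu0 (pow_ne_zero 2 hc0)) (pow_ne_zero 2 hA0),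
    Padic.valuation_mul hu0 (pow_ne_zero 2 hc0), Padic.valuation_pow, Padic.valuation_pow,
    Padic.valuation_pow, hvu, hvc, hvA, hvL]
  ring

end Valuation

variable {W : WeierstrassCurve ℚ} [W.IsElliptic] [W.IsGloballyMinimal] {p : ℕ} [Fact p.Prime]

/-! ### Bookkeeping consumers (the shape of A198's, with the three extra binders threaded) -/

/-- **Every generator satisfies the identity (with its own unit).** Granted the fact, if
`ch_Λ(𝒳_{𝓕_Gr}) = (𝓖)` for ANY `𝓖 ∈ Λ`, then `𝓖(0) = u' · c_E⁻² (1 − a_p p⁻¹ + p⁻¹)² log_{ω_E}(P_K)²`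
for some `u' ∈ ℤ_p^×` (two generators of a principal ideal of the domain `Λ = ℤ_p⟦T⟧` differ by a unit
of `Λ`, whose constant term is a unit of `ℤ_p`).
[cite: YanZhu2026, Cor. 5.4 with the proof of Thm. 5.11 (arXiv:2412.20078v4 TeX l.1166–1184, l.1347)]
[cite: CastellaGrossiSkinner2025, Prop. 3.4.2 (arXiv:2303.04373v2 TeX l.1512–1531)] -/
theorem generator_constantCoeff_eq_of_cor54 (h : cor54_prop342_thm513_generator_constantCoeff)
    (hp : 3 ≤ p) (hord : GoodOrd W p) (him : BigIm W p)
    (K : Type) [Field K] [NumberField K] (hK : IsImaginaryQuadratic K)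
    (hHN : SatisfiesHeegnerHypothesis (W.conductorNorm ℤ) K) (hHp : SatisfiesHeegnerHypothesis p K)
    (hodd : Odd (NumberField.discr K)) (h3 : NumberField.discr K ≠ -3)
    (hirr : (W.baseChange K).HasIrreducibleModPGaloisRep p)
    (ι : K →+* ℚ_[p]) (v vbar : HeightOneSpectrum (𝓞 K))
    (hv : ∀ x : 𝓞 K, x ∈ v.asIdeal ↔ ‖ι (x : K)‖ < 1)
    (hvbar : ((p : ℕ) : 𝓞 K) ∈ vbar.asIdeal) (hne : vbar ≠ v)
    (κ : ZpExtension K p) (hκ : κ.IsAnticyclotomic)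
    (γ : absoluteGaloisGroup K) [Fact (κ.IsTopGenerator γ)]
    {N : ℕ} [NeZero N] (Dt : ModularParametrizationData W N)
    (H : HeegnerDatum N (NumberField.discr K)) (ιC : K →+* ℂ) (P : (W.baseChange K).toAffine.Point)
    (hP : WeierstrassCurve.Affine.Point.map ιC.toRatAlgHom P = heegnerPointComplex Dt H)
    (hrk : (W.baseChange K).mordellWeilRank = 1)
    (hfinp : Finite (AddCommGroup.primaryComponent (W.baseChange K).sha p))
    (hPinf : ¬ IsOfFinAddOrder P)
    (G : IwasawaAlgebra p) (hG : AcSelmer.XAc.charIdeal (W.baseChange K) p κ vbar ∅ γ = Ideal.span {G}) :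
    ∃ u' : ℤ_[p]ˣ,
      ((PowerSeries.constantCoeff G : ℤ_[p]) : ℚ_[p]) =
        ((u' : ℤ_[p]) : ℚ_[p]) * ((Dt.c : ℚ_[p])⁻¹) ^ 2 *
          (1 - (W.frobeniusTrace p : ℚ_[p]) * (p : ℚ_[p])⁻¹ + (p : ℚ_[p])⁻¹) ^ 2 *
          ((W.baseChange ℚ_[p]).padicLogPoint (formalIndex W p • padicPointOf W p ι P) /
            (formalIndex W p : ℚ_[p])) ^ 2 := by
  obtain ⟨-, F, hF, u, hu⟩ :=
    h W p hp hord him K hK hHN hHp hodd h3 hirr ι v vbar hv hvbar hne κ hκ γ N Dt H ιC P hP hrk hfinp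
      hPinf
  -- `G = F · w` for a unit `w` of `Λ`; `w(0)` is a unit of `ℤ_p`
  obtain ⟨w, rfl⟩ := Ideal.span_singleton_eq_span_singleton.mp (hF.symm.trans hG)
  have hw : IsUnit (PowerSeries.constantCoeff (w : IwasawaAlgebra p)) :=
    PowerSeries.isUnit_constantCoeff _ w.isUnit
  refine ⟨u * hw.unit, ?_⟩
  rw [map_mul, PadicInt.coe_mul, hu, Units.val_mul, PadicInt.coe_mul, IsUnit.unit_spec]
  ring

/-- **The identity in valuations** — the currency of the control facts (JSW 3.3.1 = A174, CGLS 5.1.1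
= A170) and of the cell's `AcSelmer.XAc.HasCharValuationAt`: granted the fact, for EVERY generator
`𝓖` of `ch_Λ(𝒳_{𝓕_Gr})` with `𝓖(0) ≠ 0`, `ord_p 𝓖(0) = 2·(ord_p(1 − a_p + p) − 1 + ord_p log_{ω_E} P_K)
− 2·ord_p c_E`, where `ord_p log_{ω_E} P_K = padicLogOrd W p ι P`.
[cite: YanZhu2026, Cor. 5.4 with Prop. 3.14 and the proof of Thm. 5.11 (arXiv:2412.20078v4 TeX l.1166–1184, l.896–903, l.1347)]
[cite: CastellaGrossiSkinner2025, Prop. 3.4.2] [cite: CastellaGrossiLeeSkinner2022, Thm. 5.1.3] -/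
theorem valuation_generator_constantCoeff_of_cor54 (h : cor54_prop342_thm513_generator_constantCoeff)
    (hp : 3 ≤ p) (hord : GoodOrd W p) (him : BigIm W p)
    (K : Type) [Field K] [NumberField K] (hK : IsImaginaryQuadratic K)
    (hHN : SatisfiesHeegnerHypothesis (W.conductorNorm ℤ) K) (hHp : SatisfiesHeegnerHypothesis p K)
    (hodd : Odd (NumberField.discr K)) (h3 : NumberField.discr K ≠ -3)
    (hirr : (W.baseChange K).HasIrreducibleModPGaloisRep p)
    (ι : K →+* ℚ_[p]) (v vbar : HeightOneSpectrum (𝓞 K))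
    (hv : ∀ x : 𝓞 K, x ∈ v.asIdeal ↔ ‖ι (x : K)‖ < 1)
    (hvbar : ((p : ℕ) : 𝓞 K) ∈ vbar.asIdeal) (hne : vbar ≠ v)
    (κ : ZpExtension K p) (hκ : κ.IsAnticyclotomic)
    (γ : absoluteGaloisGroup K) [Fact (κ.IsTopGenerator γ)]
    {N : ℕ} [NeZero N] (Dt : ModularParametrizationData W N)
    (H : HeegnerDatum N (NumberField.discr K)) (ιC : K →+* ℂ) (P : (W.baseChange K).toAffine.Point)
    (hP : WeierstrassCurve.Affine.Point.map ιC.toRatAlgHom P = heegnerPointComplex Dt H)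
    (hrk : (W.baseChange K).mordellWeilRank = 1)
    (hfinp : Finite (AddCommGroup.primaryComponent (W.baseChange K).sha p))
    (hPinf : ¬ IsOfFinAddOrder P)
    (G : IwasawaAlgebra p) (hG : AcSelmer.XAc.charIdeal (W.baseChange K) p κ vbar ∅ γ = Ideal.span {G})
    (hG0 : PowerSeries.constantCoeff G ≠ 0) :
    ((PowerSeries.constantCoeff G).valuation : ℤ) =
      2 * ((padicValInt p (1 - W.frobeniusTrace p + p) : ℤ) - 1 + padicLogOrd W p ι P) -
        2 * (padicValInt p Dt.c : ℤ) := by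
  obtain ⟨u', hu'⟩ := generator_constantCoeff_eq_of_cor54 h hp hord him K hK hHN hHp hodd h3 hirr
    ι v vbar hv hvbar hne κ hκ γ Dt H ιC P hP hrk hfinp hPinf G hG
  -- the left-hand side is non-zero, hence so is the right-hand side
  have hrhs : ((u' : ℤ_[p]) : ℚ_[p]) * ((Dt.c : ℚ_[p])⁻¹) ^ 2 *
      (1 - (W.frobeniusTrace p : ℚ_[p]) * (p : ℚ_[p])⁻¹ + (p : ℚ_[p])⁻¹) ^ 2 *
      ((W.baseChange ℚ_[p]).padicLogPoint (formalIndex W p • padicPointOf W p ι P) /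
        (formalIndex W p : ℚ_[p])) ^ 2 ≠ 0 := by
    rw [← hu']
    exact PadicInt.coe_ne_zero.2 hG0
  have hval := congrArg Padic.valuation hu'
  rw [PadicInt.valuation_coe, valuation_unit_mul_bdpShape_yz54 u' Dt.c (W.frobeniusTrace p) _ _ hrhs]
    at hval
  rw [hval, padicLogOrd]

/-- **Cor. 5.4 ∘ Prop. 3.14 ∘ CGS Prop. 3.4.2 ∘ CGLS Thm. 5.1.3 at the trivial character in the
packaged currency** `AcSelmer.XAc.HasCharValuationAt … n` ("`𝒳_{𝓕_Gr}` is `Λ`-torsion with a generator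
`𝓕`, `𝓕(0) ≠ 0`, `ord_p 𝓕(0) = n`") `∧ n = 2·(ord_p(1 − a_p + p) − 1 + ord_p log_{ω_E} P_K) − 2·ord_p
c_E` — granted the fact and ONE generator with non-zero constant term (at the cell's data this comes
from a control theorem: JSW Thm. 3.3.1 at every pair). Up to the Manin term `2·ord_p c_E` (absent for
a parametrisation with `p ∤ c_E`) and the log-prime convention this is LITERALLY the body of the
cell's Summits predicate `X11b.IMCWaldspurgerOnTreeGoodAt p κ vbar γ ι P`, now fed — at every ODD good
ordinary `p` with (Im) and (irr_K), in particular at `p = 3`, in analytic rank one — by PUBLISHED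
statements only (the drop-in replacement of `hasCharValuationAt_of_thm412` in
`X11b.imcWaldspurgerOnTreeGoodAt_inducedPlace_of_thm412_of_thm331`, whose binders `hrk`, `hfinp`,
`hPinf` are the three extra arguments).
[cite: YanZhu2026, Cor. 5.4, Prop. 3.14, proof of Thm. 5.11 (arXiv:2412.20078v4 TeX l.1166–1184, l.896–903, l.1347)]
[cite: CastellaGrossiSkinner2025, Prop. 3.4.2] [cite: CastellaGrossiLeeSkinner2022, Thm. 5.1.3]
[cite: Castella2018, §5 (eq:IMC+BDP) (arXiv:1704.06608 p. 12) (the same shape at `p ∣ N`)] -/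
theorem hasCharValuationAt_of_cor54 (h : cor54_prop342_thm513_generator_constantCoeff)
    (hp : 3 ≤ p) (hord : GoodOrd W p) (him : BigIm W p)
    (K : Type) [Field K] [NumberField K] (hK : IsImaginaryQuadratic K)
    (hHN : SatisfiesHeegnerHypothesis (W.conductorNorm ℤ) K) (hHp : SatisfiesHeegnerHypothesis p K)
    (hodd : Odd (NumberField.discr K)) (h3 : NumberField.discr K ≠ -3)
    (hirr : (W.baseChange K).HasIrreducibleModPGaloisRep p)
    (ι : K →+* ℚ_[p]) (v vbar : HeightOneSpectrum (𝓞 K))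
    (hv : ∀ x : 𝓞 K, x ∈ v.asIdeal ↔ ‖ι (x : K)‖ < 1)
    (hvbar : ((p : ℕ) : 𝓞 K) ∈ vbar.asIdeal) (hne : vbar ≠ v)
    (κ : ZpExtension K p) (hκ : κ.IsAnticyclotomic)
    (γ : absoluteGaloisGroup K) [Fact (κ.IsTopGenerator γ)]
    {N : ℕ} [NeZero N] (Dt : ModularParametrizationData W N)
    (H : HeegnerDatum N (NumberField.discr K)) (ιC : K →+* ℂ) (P : (W.baseChange K).toAffine.Point)
    (hP : WeierstrassCurve.Affine.Point.map ιC.toRatAlgHom P = heegnerPointComplex Dt H)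
    (hrk : (W.baseChange K).mordellWeilRank = 1)
    (hfinp : Finite (AddCommGroup.primaryComponent (W.baseChange K).sha p))
    (hPinf : ¬ IsOfFinAddOrder P)
    (G : IwasawaAlgebra p) (hG : AcSelmer.XAc.charIdeal (W.baseChange K) p κ vbar ∅ γ = Ideal.span {G})
    (hG0 : PowerSeries.constantCoeff G ≠ 0) :
    ∃ n : ℕ, AcSelmer.XAc.HasCharValuationAt (W.baseChange K) p κ vbar ∅ γ n ∧
      (n : ℤ) = 2 * ((padicValInt p (1 - W.frobeniusTrace p + p) : ℤ) - 1 + padicLogOrd W p ι P) -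
        2 * (padicValInt p Dt.c : ℤ) := by
  obtain ⟨htors, -⟩ :=
    h W p hp hord him K hK hHN hHp hodd h3 hirr ι v vbar hv hvbar hne κ hκ γ N Dt H ιC P hP hrk hfinp
      hPinf
  exact ⟨(PowerSeries.constantCoeff G).valuation,
    AcSelmer.XAc.hasCharValuationAt_of_eq htors hG hG0 rfl,
    valuation_generator_constantCoeff_of_cor54 h hp hord him K hK hHN hHp hodd h3 hirr ι v vbar hv
      hvbar hne κ hκ γ Dt H ιC P hP hrk hfinp hPinf G hG hG0⟩

end Literature.NumberTheory.EllipticCurves.YanZhu2026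

end
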